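import Summits.CriticalPhenomena.PercolationContinuityZ3.Theorems.PercNearOneGluingNoHeavyQuantLawDecFlows
import HarnessLib

/-!
# QUANT lane R8, T-DEC: the two MÖBIUS INEQUALITIES behind the light-straddler case of `LawDec.SliceLawSW` (memo SINGLE-LAYER-G55 §3c)

builds on p205010 (kernel theorem, internal audit signed; external expert review pending)

Support file (`--supports stmt-CriticalPhenomena-4575`), QUANT lane seat prim-quant-census-2 (gen 55), rung R8 of `run/shared/lean/prim/quant/LADDER.md`.
One small definition (the light-branch usage rate as a function of `ρ`), theorems with standard axioms, no sorries.

On the LIGHT branch the usage rate of a credit pair with credit ratio `ρ = (T − 2l)/(h − l) < x` is `U(ρ) = γ/(1−γ)` with `γ = x² + (1−x)ρ`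
(`LawDec.pairGate` = `max(ρ, x² + (1−x)ρ) = x² + (1−x)ρ` when `ρ ≤ x`), and `1 − γ = (1−x)(1+x−ρ)` gives the MÖBIUS FORM `U(ρ) + 1 = 1/((1−x)(1+x−ρ))`
(`lightUsage_add_one`); also `U(x) = x/(1−x)` (the giant rate).  For a deep low `l` and a light window mid `h` (`N = T−2l`, `D = h−l`, `N < xD`) the
explicit transfer of memo §3c makes the transferred slice law DEC iff
* **(I-A)** `(1−g)·x/(1−x) + g·U(ρ_ad) ≤ U(ρ⁰)` when the row-0 pair is heavy or dead at the raised target (`xD ≤ N + ag`), and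
* **(I-B)** `g·U(ρ_ad) + (1−g)·U(ρ′) ≤ U(ρ⁰)` when it is light (`N + ag < xD`),
where `ρ⁰ = N/D`, `ρ_ad = (N + ag − 2a)/(D − a)` (the anti-diagonal pair `(l+a, h)`), `ρ′ = (N + ag)/D` (the pair `(l, h)` at `T + ag`).  Both are proved here
as pure real inequalities (`x ≤ g < 1`, `0 < a < D`, `a(2−g) < N < xD`); the proofs are the hand reductions of the memo (exactly checked on 6·10⁴ random rational
points and a 1.1·10⁶-cell grid, code/algcheck.py, swineq.py): (I-B) ⟺ `Q·D = (D−N)(D(1+x)−N) + a(gN − D + xD(1−g)) > 0`; (I-A) by `0 < xD − N ≤ ag` and `g ≥ x`.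

* `LawDec.lightUsage x ρ = (x² + (1−x)ρ)/(1 − (x² + (1−x)ρ))`; `lightUsage_add_one`; `lightUsage_at_floor` (`= x/(1−x)` at `ρ = x`).
* **`LawDec.mobius_IB`**, **`LawDec.mobius_IA`**.

[this work].  The gluing rows served [cite: KozmaNitzan2024, Conjecture 3 (p. 15)]; product measure [cite: Grimmett1999, §1.3 p. 10].
-/

noncomputable section

namespace Summit.CriticalPhenomena.PercolationContinuityZ3.Theorems

namespace Quant

namespace LawDec

/-- **the light-branch usage rate** as a function of the credit ratio `ρ`: `γ/(1−γ)`, `γ = x² + (1−x)ρ`. [this work] -/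
def lightUsage (x ρ : ℝ) : ℝ := (x ^ 2 + (1 - x) * ρ) / (1 - (x ^ 2 + (1 - x) * ρ))

/-- **Möbius form**: `U(ρ) + 1 = 1/((1−x)(1+x−ρ))` (`x < 1`, `ρ < 1 + x`). [this work] -/
theorem lightUsage_add_one (x ρ : ℝ) (hx1 : x < 1) (hρ : ρ < 1 + x) :
    lightUsage x ρ + 1 = 1 / ((1 - x) * (1 + x - ρ)) := by
  have hden : 1 - (x ^ 2 + (1 - x) * ρ) = (1 - x) * (1 + x - ρ) := by ring
  have hpos : 0 < (1 - x) * (1 + x - ρ) := mul_pos (by linarith) (by linarith)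
  unfold lightUsage
  rw [hden, div_add_one hpos.ne']
  congr 1
  ring

/-- at `ρ = x` the light-branch rate is the giant rate `x/(1−x)`. [this work] -/
theorem lightUsage_at_floor (x : ℝ) : lightUsage x x = x / (1 - x) := by
  unfold lightUsage
  have e1 : x ^ 2 + (1 - x) * x = x := by ring
  rw [e1]

/-- **(I-B)**: `g·U(ρ_ad) + (1−g)·U(ρ′) ≤ U(ρ⁰)` for `0 < x < 1`, `x ≤ g < 1`, `0 < a < D`, `a(2−g) < N`, `N + ag < xD` (row-0 pair light at the raised target).
Proof: in the Möbius form it reads `g/A + (1−g)/C ≤ 1/B` (`A = 1+x−ρ_ad`, `B = 1+x−ρ⁰`, `C = 1+x−ρ′`), and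
`AC − B(gC + (1−g)A) = g·(B(ρ′−ρ_ad) − aA/D) = g·a·QD/(D²(D−a))` with `QD = (D−N)(D(1+x)−N) + a(gN − D + xD(1−g)) > 0`. [this work] -/
theorem mobius_IB (x g a N D : ℝ) (hx0 : 0 < x) (hx1 : x < 1) (hxg : x ≤ g) (hg1 : g < 1) (ha : 0 < a) (haD : a < D)
    (hdeep : a * (2 - g) < N) (hlight' : N + a * g < x * D) :
    g * lightUsage x ((N + a * g - 2 * a) / (D - a)) + (1 - g) * lightUsage x ((N + a * g) / D)
      ≤ lightUsage x (N / D) := by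
  have hD : 0 < D := ha.trans haD
  have hDa : 0 < D - a := by linarith
  have h1x : 0 < 1 - x := by linarith
  have hg0 : 0 < g := hx0.trans_le hxg
  have hN0 : 0 < N := lt_trans (mul_pos ha (by linarith)) hdeep
  have hNxD : N < x * D := by nlinarith
  set q : ℝ := (N + a * g - 2 * a) / (D - a) with hq
  set r : ℝ := (N + a * g) / D with hr
  set p : ℝ := N / D with hp
  have hq1 : q < 1 + x := by rw [hq, div_lt_iff₀ hDa]; nlinarith
  have hr1 : r < 1 + x := by rw [hr, div_lt_iff₀ hD]; nlinarith
  have hp1 : p < 1 + x := by rw [hp, div_lt_iff₀ hD]; nlinarith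
  have hA : 0 < 1 + x - q := by linarith
  have hB : 0 < 1 + x - p := by linarith
  have hC : 0 < 1 + x - r := by linarith
  have e1 : lightUsage x q = 1 / ((1 - x) * (1 + x - q)) - 1 := by linarith [lightUsage_add_one x q hx1 hq1]
  have e2 : lightUsage x r = 1 / ((1 - x) * (1 + x - r)) - 1 := by linarith [lightUsage_add_one x r hx1 hr1]
  have e3 : lightUsage x p = 1 / ((1 - x) * (1 + x - p)) - 1 := by linarith [lightUsage_add_one x p hx1 hp1]
  rw [e1, e2, e3]
  -- the polynomial certificate
  set QD : ℝ := (D - N) * (D * (1 + x) - N) + a * (g * N - D + x * D * (1 - g)) with hQD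
  have hu : 0 < x * D - N - a * g := by linarith
  have hv : 0 < x * D - N := by linarith
  have hQD_pos : 0 < QD := by
    have hDag : 0 < D - a * (1 - g) := by nlinarith
    have expand : QD = (x * D - N - a * g) * (x * D - N) + (x * D - N - a * g) * D + (1 - x) * D * (x * D - N)
        + a * g * (x * D - N) + a * g * N + (1 - x) * D * (D - a * (1 - g)) := by
      rw [hQD]; ring
    rw [expand]
    have t1 := mul_pos hu hv
    have t2 := mul_pos hu hD
    have t3 := mul_pos (mul_pos h1x hD) hv
    have t4 := mul_pos (mul_pos ha hg0) hv
    have t5 := mul_pos (mul_pos ha hg0) hN0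
    have t6 := mul_pos (mul_pos h1x hD) hDag
    linarith
  -- the identity AC − B(gC + (1−g)A) = g·a·QD/(D²(D−a))
  have key : (1 + x - q) * (1 + x - r) - (1 + x - p) * (g * (1 + x - r) + (1 - g) * (1 + x - q))
      = g * a * QD / (D ^ 2 * (D - a)) := by
    rw [hq, hr, hp, hQD]
    field_simp
    ring
  have hrhs : 0 ≤ g * a * QD / (D ^ 2 * (D - a)) := by positivity
  -- g/A + (1−g)/C ≤ 1/B
  have hAC : g / (1 + x - q) + (1 - g) / (1 + x - r) ≤ 1 / (1 + x - p) := by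
    rw [div_add_div _ _ hA.ne' hC.ne', div_le_div_iff₀ (mul_pos hA hC) hB]
    linarith [key, hrhs]
  have hdiv := div_le_div_of_nonneg_right hAC h1x.le
  have eL : g * (1 / ((1 - x) * (1 + x - q)) - 1) + (1 - g) * (1 / ((1 - x) * (1 + x - r)) - 1)
      = (g / (1 + x - q) + (1 - g) / (1 + x - r)) / (1 - x) - 1 := by
    field_simp
    ring
  have eR : 1 / ((1 - x) * (1 + x - p)) - 1 = (1 / (1 + x - p)) / (1 - x) - 1 := by
    field_simp
  rw [eL, eR]
  linarith

/-- **(I-A)**: `(1−g)·x/(1−x) + g·U(ρ_ad) ≤ U(ρ⁰)` for `0 < x < 1`, `x ≤ g < 1`, `0 < a < D`, `a(2−g) < N < xD`, `xD ≤ N + ag` (row-0 pair heavy or dead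
at the raised target).  Proof: in the Möbius form it reads `(1−g) + g/A ≤ 1/B`, i.e. `B((1−g)A + g) ≤ A`; clearing denominators,
`(1−g)[(xD−N)((1+x)D−N) + a((1+x)(2−g−x)D + (x+g−1)N)] ≤ a[(2−g)D − gN]`, which follows from `0 < xD − N ≤ ag`, `g ≥ x` (memo §3c). [this work] -/
theorem mobius_IA (x g a N D : ℝ) (hx0 : 0 < x) (hx1 : x < 1) (hxg : x ≤ g) (hg1 : g < 1) (ha : 0 < a) (haD : a < D)
    (hdeep : a * (2 - g) < N) (hNx : N < x * D) (hheavy' : x * D ≤ N + a * g) :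
    (1 - g) * (x / (1 - x)) + g * lightUsage x ((N + a * g - 2 * a) / (D - a)) ≤ lightUsage x (N / D) := by
  have hD : 0 < D := ha.trans haD
  have hDa : 0 < D - a := by linarith
  have h1x : 0 < 1 - x := by linarith
  have hg0 : 0 < g := hx0.trans_le hxg
  have hN0 : 0 < N := lt_trans (mul_pos ha (by linarith)) hdeep
  set q : ℝ := (N + a * g - 2 * a) / (D - a) with hq
  set p : ℝ := N / D with hp
  have hq1 : q < 1 + x := by rw [hq, div_lt_iff₀ hDa]; nlinarith
  have hp1 : p < 1 + x := by rw [hp, div_lt_iff₀ hD]; nlinarith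
  have hA : 0 < 1 + x - q := by linarith
  have hB : 0 < 1 + x - p := by linarith
  have e1 : lightUsage x q = 1 / ((1 - x) * (1 + x - q)) - 1 := by linarith [lightUsage_add_one x q hx1 hq1]
  have e3 : lightUsage x p = 1 / ((1 - x) * (1 + x - p)) - 1 := by linarith [lightUsage_add_one x p hx1 hp1]
  rw [e1, e3]
  -- polynomial certificate: A − B((1−g)A + g) = P/(D(D−a)) with
  --   P·(1) = a[(2−g)D − gN] − (1−g)[(xD−N)((1+x)D−N) + a((1+x)(2−g−x)D + (x+g−1)N)]  ≥ 0
  set P : ℝ := a * ((2 - g) * D - g * N) - (1 - g) * ((x * D - N) * ((1 + x) * D - N)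
      + a * ((1 + x) * (2 - g - x) * D + (x + g - 1) * N)) with hP
  have hP_nonneg : 0 ≤ P := by
    -- step 1: (xD − N)((1+x)D − N) ≤ a g ((1+x)D − N)
    have hw : 0 < (1 + x) * D - N := by nlinarith
    have hs1 : (x * D - N) * ((1 + x) * D - N) ≤ a * g * ((1 + x) * D - N) :=
      mul_le_mul_of_nonneg_right (by linarith) hw.le
    -- step 2: the bound after step 1 is (1−g)a[(1+x)(2−x)D − (1−x)N] and a[(2−g)D − gN] − that ≥ 0
    have hc1 : 0 < 1 + x - x ^ 2 := by nlinarith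
    have hcoefD : x ^ 2 * (2 - x) ≤ (2 - g) - (1 - g) * ((1 + x) * (2 - x)) := by
      nlinarith [mul_nonneg (sub_nonneg.2 hxg) hc1.le]
    have hcD0 : 0 ≤ (2 - g) - (1 - g) * ((1 + x) * (2 - x)) :=
      le_trans (mul_nonneg (sq_nonneg x) (by linarith)) hcoefD
    have hfin : 0 ≤ a * ((2 - g) * D - g * N) - (1 - g) * a * ((1 + x) * (2 - x) * D - (1 - x) * N) := by
      -- = a [ D·c_D − N·c_N ],  c_D − x·c_N = g(1−x), N < xD
      have idn : ((2 - g) - (1 - g) * ((1 + x) * (2 - x))) - x * (g - (1 - g) * (1 - x)) = g * (1 - x) := by ring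
      have hDN : 0 ≤ D * ((2 - g) - (1 - g) * ((1 + x) * (2 - x))) - N * (g - (1 - g) * (1 - x)) := by
        by_cases hcN : 0 ≤ g - (1 - g) * (1 - x)
        · have h1 : N * (g - (1 - g) * (1 - x)) ≤ x * D * (g - (1 - g) * (1 - x)) :=
            mul_le_mul_of_nonneg_right hNx.le hcN
          have h2 : D * ((2 - g) - (1 - g) * ((1 + x) * (2 - x))) - x * D * (g - (1 - g) * (1 - x)) = D * (g * (1 - x)) := by
            linear_combination D * idn
          have h3 : 0 < D * (g * (1 - x)) := mul_pos hD (mul_pos hg0 h1x)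
          linarith
        · have h1 : N * (g - (1 - g) * (1 - x)) ≤ 0 := mul_nonpos_of_nonneg_of_nonpos hN0.le (le_of_lt (not_le.1 hcN))
          have h3 : 0 ≤ D * ((2 - g) - (1 - g) * ((1 + x) * (2 - x))) := mul_nonneg hD.le hcD0
          linarith
      have : a * ((2 - g) * D - g * N) - (1 - g) * a * ((1 + x) * (2 - x) * D - (1 - x) * N)
          = a * (D * ((2 - g) - (1 - g) * ((1 + x) * (2 - x))) - N * (g - (1 - g) * (1 - x))) := by ring
      rw [this]; exact mul_nonneg ha.le hDN
    have h1g : 0 ≤ 1 - g := by linarith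
    have expandP : P = a * ((2 - g) * D - g * N) - (1 - g) * a * ((1 + x) * (2 - x) * D - (1 - x) * N)
        + (1 - g) * (a * g * ((1 + x) * D - N) - (x * D - N) * ((1 + x) * D - N)) := by
      rw [hP]; ring
    rw [expandP]
    have h4 := mul_nonneg h1g (sub_nonneg.2 hs1)
    linarith
  have key : (1 + x - q) - (1 + x - p) * ((1 - g) * (1 + x - q) + g) = P / (D * (D - a)) := by
    rw [hq, hp, hP]
    field_simp
    ring
  have hrhs : 0 ≤ P / (D * (D - a)) := by positivity
  -- (1−g) + g/A ≤ 1/B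
  have hAB : (1 - g) + g / (1 + x - q) ≤ 1 / (1 + x - p) := by
    have e : (1 - g) + g / (1 + x - q) = ((1 - g) * (1 + x - q) + g) / (1 + x - q) := by
      field_simp
    rw [e, div_le_div_iff₀ hA hB]
    linarith [key, hrhs]
  have hdiv := div_le_div_of_nonneg_right hAB h1x.le
  have eL : (1 - g) * (x / (1 - x)) + g * (1 / ((1 - x) * (1 + x - q)) - 1)
      = ((1 - g) + g / (1 + x - q)) / (1 - x) - 1 := by
    field_simp
    ring
  have eR : 1 / ((1 - x) * (1 + x - p)) - 1 = (1 / (1 + x - p)) / (1 - x) - 1 := by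
    field_simp
  rw [eL, eR]
  linarith

end LawDec

end Quant

end Summit.CriticalPhenomena.PercolationContinuityZ3.Theorems
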